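import Literature.Computability.MetaComplexity.RandReductions
import Literature.Computability.Complexity.RandomizedProofs
import Literature.Computability.Complexity.StringSwap
import Literature.Computability.Complexity.BPPErrorReduction
import HarnessLib

/-!
# Randomized reductions: one-sided to two-sided error (proofs; trunk CplxMeta)

Sibling proof file of `RandReductions.lean` (D-0014: named facts `def X : Prop` are discharged
as `theorem X_holds : X`). It discharges

* `Literature.Computability.MetaComplexity.PolyTimeRPReducible.polyTimeRandReducible_holds` — a one-sided (`RP`-type,
  success `≥ 1/2`, no false positives) randomized polynomial-time many-one reduction from `L₁` to
  a target `L₂` admitting a polynomial-time OR-combiner `g` (`g ⟨y₁, y₂⟩ ∈ L₂ ↔ y₁ ∈ L₂ ∨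
  y₂ ∈ L₂`) is a two-sided randomized reduction in the sense of Arora–Barak, Def. 7.16
  (`Pr_r[L₂(A(x; r)) = L₁(x)] ≥ 2/3`).

## Proof architecture

The printed argument is the error reduction for one-sided error by independent repetition
(Arora–Barak 2009, §7.3 "`RP ⊆ BPP`", §7.4.1 with Thm. 7.10 and the remark after it: "a similar
(and even easier to prove) result holds for the one-sided error classes", Exercise 7.4),
transplanted from deciders to many-one reductions by the OR-combiner: run the reduction twice on
independent coins and query `g ⟨y₁, y₂⟩`. If `x ∈ L₁` each run lands in `L₂` with probability
`≥ 1/2`, so both fail with probability `≤ 1/4` and the verdict is correct with probability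
`≥ 3/4 ≥ 2/3`; if `x ∉ L₁` no coin string of the prescribed length lands in `L₂`, so the
verdict is correct with probability `1`.

Formal content, in the vendored model (`RandAlg`, `Randomized.lean`):

* *coins* — the coin budget `A.coinLen` of a `RandAlg` is an arbitrary (polynomially bounded,
  possibly non-computable) function, so the machine cannot cut a coin string of length `2m`
  at `m = coinLen |x|`; instead the two runs read the coins at the *even* and at the *odd*
  positions (`everyOther true r`, `everyOther false r`), a split that is oblivious of `m` and is
  computed by a two-state finite-state transducer (`everyOtherT`, hence `everyOther b ∈ FP` by
  `FST.polyTimeComputable_eval`, `Transducers.lean`). The new algorithm is `A.orTwice g` with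
  `coinLen n = 2 · A.coinLen n`.
* *machines* — no Turing machine is programmed: the run map of `A.orTwice g`, read through the
  pairing `⟨x, r⟩ = boolPair x r`, is the composite
  `g ∘ mapSndFn B₀ ∘ mapFstFn B₁ ∘ copyFn` with `B_b = (uncurry A.run ∘ boolUnpair) ∘
  mapSndFn (everyOther b)` of maps already in `FP` (`copyFn_mem_FP`, `StringCopy.lean`;
  `mapFstFn_mem_FP`, `MapFstMachine.lean`; `mapSndFn_mem_FP`, `StringSwap.lean`;
  `polyTimeComputable_boolUnpair`, `PairingMachines.lean`; `PolyTimeComputable.comp_holds`,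
  `TimeBoundsProofs.lean`), transported to the pair presentation by
  `PolyTimeComputable.of_encode_eq` (`RandomizedProofs.lean`) — `RandAlg.orTwice_isPolyTime`.
* *probability* — `RandAlg.pr` is the counting probability `uniformProb`
  (`RandAlg.pr_eq_uniformProb`, `BPPErrorReduction.lean`); the product rule for deinterleaved
  blocks `#{y ∈ {0,1}^{2m} | everyOther true y ∈ E ∧ everyOther false y ∈ F} = #E · #F`
  (`cnt_everyOther`, by splitting off the first two coins, `cnt_succ`) replaces the prefix/suffix
  product rule `cnt_take_drop` used for `RP_subset_BPP_holds` (`ProbabilisticClassesProofs.lean`),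
  whose integer arithmetic (`(2^m - a)^2 ≤ 4^m / 4` for `2a ≥ 2^m`) is reused verbatim
  (`two_mul_pow_le_three_mul_cnt_everyOther_or`).

Main results: `Literature.Computability.MetaComplexity.everyOther`, `everyOther_mem_FP`, `cnt_everyOther`, `RandAlg.orTwice`,
`RandAlg.orTwice_isPolyTime`, `PolyTimeRPReducible.polyTimeRandReducible_holds`.

## References

* S. Arora, B. Barak, *Computational Complexity: A Modern Approach*, CUP 2009
  (doi:10.1017/cbo9780511804090): Def. 7.16 (p. 138, randomized reduction `B ≤ᵣ C`:
  "`Pr[C(M(x)) = B(x)] ≥ 2/3`"), §7.3 (p. 131–132, `RP ⊆ BPP`), §7.4.1 and Thm. 7.10 (p. 132,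
  error reduction by independent repetitions; "A similar (and even easier to prove) result
  holds for the one-sided error classes **RP** and **coRP**; see Exercise 7.4"), Exercise 7.4
  (pp. 141–142, error reduction for `RP`), Claim 1.6 / Thm. 2.8 (closure under composition).
* L. Valiant, V. Vazirani, *NP is as easy as detecting unique solutions*, TCS 47 (1986), §1
  (one-sided randomized reductions and their amplification).
* J. Hopcroft, J. Ullman, *Introduction to Automata Theory, Languages, and Computation*,
  Addison-Wesley 1979, §2.7 (Mealy machines; the deinterleaving transducer).
-/

namespace Literature.Computability.MetaComplexity

open _root_.Computability

/-! ### Deinterleaving a coin string -/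

/-- `everyOther b r`: every other symbol of `r` — the symbols at even positions `0, 2, 4, …` if
`b = true`, those at odd positions `1, 3, 5, …` if `b = false`. On a uniformly random
`r ∈ {0,1}^{2m}` the two halves `everyOther true r`, `everyOther false r ∈ {0,1}^m` are
independent and uniform (`cnt_everyOther`): the "independent repetitions" of Arora–Barak's error
reduction, cut out of one coin string without knowing `m`.
[Arora–Barak 2009, §7.4.1 (independent repetitions)] [folklore] -/
def everyOther : Bool → List Bool → List Bool
  | _, [] => []
  | true, a :: r => a :: everyOther false r
  | false, _ :: r => everyOther true r

/-- `everyOther b [] = []`. [folklore] -/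
@[simp] theorem everyOther_nil (b : Bool) : everyOther b [] = [] := by cases b <;> rfl

/-- Even positions of `a :: r`: `a`, then the odd positions of `r`. [folklore] -/
@[simp] theorem everyOther_true_cons (a : Bool) (r : List Bool) :
    everyOther true (a :: r) = a :: everyOther false r :=
  rfl

/-- Odd positions of `a :: r`: the even positions of `r`. [folklore] -/
@[simp] theorem everyOther_false_cons (a : Bool) (r : List Bool) :
    everyOther false (a :: r) = everyOther true r :=
  rfl

/-- Lengths of the two halves: `⌈|r|/2⌉` even positions, `⌊|r|/2⌋` odd positions. [folklore] -/
theorem length_everyOther (r : List Bool) :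
    (everyOther true r).length = (r.length + 1) / 2 ∧
      (everyOther false r).length = r.length / 2 := by
  induction r with
  | nil => simp
  | cons a r ih =>
    simp only [everyOther_true_cons, everyOther_false_cons, List.length_cons]
    omega

/-- On a string of length `2m` both halves have length `m`. [folklore] -/
theorem length_everyOther_of_length_eq {m : ℕ} {r : List Bool} (h : r.length = m + m) (b : Bool) :
    (everyOther b r).length = m := by
  have := length_everyOther r
  cases b <;> omega

/-- The deinterleaving transducer: state `true` emits the symbol read, state `false` skips it,
and the state alternates; started in state `b` it computes `everyOther b`. [Hopcroft–Ullman 1979,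
§2.7 (Mealy machines)] [folklore] -/
def everyOtherT (b : Bool) : Complexity.FST Bool Bool Bool where
  init := b
  step s a := (!s, bif s then [a] else [])
  front _ := []
  keep _ := true

/-- From state `s` the transducer emits `everyOther s r`. [folklore] -/
theorem everyOtherT_run (b₀ : Bool) :
    ∀ (s : Bool) (r : List Bool), ((everyOtherT b₀).run s r).2 = everyOther s r
  | s, [] => by cases s <;> rfl
  | true, a :: r => by simpa [Complexity.FST.run_cons, everyOtherT] using everyOtherT_run b₀ false r
  | false, a :: r => by simpa [Complexity.FST.run_cons, everyOtherT] using everyOtherT_run b₀ true r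

/-- `(everyOtherT b).eval = everyOther b`. [folklore] -/
theorem everyOtherT_eval (b : Bool) (r : List Bool) : (everyOtherT b).eval r = everyOther b r := by
  have he : (everyOtherT b).eval r = ((everyOtherT b).run b r).2 := by simp [Complexity.FST.eval, everyOtherT]
  rw [he, everyOtherT_run]

/-- **Deinterleaving is polynomial time**: `everyOther b ∈ FP` (a finite-state transduction,
`FST.polyTimeComputable_eval`). [Arora–Barak 2009, §1.3; Hopcroft–Ullman 1979, §2.7] [folklore] -/
theorem everyOther_mem_FP (b : Bool) : everyOther b ∈ Complexity.FP := by
  have h : everyOther b = (everyOtherT b).eval := funext fun r => (everyOtherT_eval b r).symm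
  rw [h]
  exact (everyOtherT b).polyTimeComputable_eval

/-- **Product rule for deinterleaved coin blocks**: the strings `y ∈ {0,1}^{2m}` whose even
half lies in `E` and whose odd half lies in `F` number `cnt m E · cnt m F` (split off the first
two coins, `cnt_succ`, and induct). This is the independence of the two repetitions.
[Arora–Barak 2009, §7.4.1 (independent repetitions)] [folklore] -/
theorem cnt_everyOther (m : ℕ) (E F : Set (List Bool)) :
    Complexity.cnt (m + m) {y | everyOther true y ∈ E ∧ everyOther false y ∈ F} = Complexity.cnt m E * Complexity.cnt m F := by
  classical
  induction m generalizing E F with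
  | zero =>
    rw [Nat.add_zero, Complexity.cnt_zero, Complexity.cnt_zero, Complexity.cnt_zero]
    by_cases hE : [] ∈ E <;> by_cases hF : [] ∈ F <;> simp [hE, hF]
  | succ m ih =>
    have h2 : m + 1 + (m + 1) = m + m + 1 + 1 := by omega
    have key : ∀ a b : Bool,
        Complexity.cnt (m + m)
            {y | b :: y ∈ {y | a :: y ∈ {y | everyOther true y ∈ E ∧ everyOther false y ∈ F}}} =
          Complexity.cnt m {z | a :: z ∈ E} * Complexity.cnt m {z | b :: z ∈ F} := by
      intro a b
      rw [← ih]
      rfl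
    rw [h2, Complexity.cnt_succ, Complexity.cnt_succ (m + m), Complexity.cnt_succ (m + m), key, key, key, key, Complexity.cnt_succ m E,
      Complexity.cnt_succ m F]
    ring

/-- **Two independent one-sided runs, counted.** If at least half of the coin blocks of length
`m` are good (`2^m ≤ 2 · cnt m E`), then at least `3/4` (here: `2/3`) of the strings of length
`2m` have a good even half or a good odd half: the bad ones number `(2^m - a)^2 ≤ 4^m / 4`
(`cnt_everyOther` on the complements). The integer arithmetic is that of `RP_subset_BPP_holds`.
[Arora–Barak 2009, §7.3 (`RP ⊆ BPP`) and §7.4.1, Exercise 7.4 (error reduction for `RP`)]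
[cite: AroraBarak2009, §7.4.1 and Exercise 7.4] -/
theorem two_mul_pow_le_three_mul_cnt_everyOther_or {m : ℕ} {E : Set (List Bool)}
    (ha : 2 ^ m ≤ 2 * Complexity.cnt m E) :
    2 * 2 ^ (m + m) ≤ 3 * Complexity.cnt (m + m) {y | everyOther true y ∈ E ∨ everyOther false y ∈ E} := by
  have hcompl : Complexity.cnt (m + m) {y : List Bool | everyOther true y ∈ E ∨ everyOther false y ∈ E} +
      Complexity.cnt (m + m) {y : List Bool | everyOther true y ∈ Eᶜ ∧ everyOther false y ∈ Eᶜ} =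
        2 ^ (m + m) := by
    rw [← Complexity.cnt_add_cnt_compl (m + m)
      {y : List Bool | everyOther true y ∈ E ∨ everyOther false y ∈ E}]
    congr 1
    exact Complexity.cnt_congr fun y _ => by simp [not_or]
  have hprod := cnt_everyOther m Eᶜ Eᶜ
  have hEc := Complexity.cnt_add_cnt_compl m E
  rw [hprod] at hcompl
  have hpow : (2 : ℕ) ^ (m + m) = 2 ^ m * 2 ^ m := pow_add 2 m m
  nlinarith [hcompl, hEc, ha, hpow, Nat.zero_le (Complexity.cnt m Eᶜ), Nat.zero_le (Complexity.cnt m E)]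

/-! ### Two runs combined by an OR-combiner -/

section RandAlg
open Literature.Computability.Complexity (RandAlg)
open Literature.Computability.Complexity.RandAlg

/-- `A.orTwice g`: the two-run amplification of a randomized string algorithm `A` through a
combiner `g` — on input `x` with coins `r`, run `A` on `x` with the even-position coins and
with the odd-position coins and output `g ⟨y₁, y₂⟩`; coin budget `2 · A.coinLen`.
("Run `M(x)` `k` times with independent coins"; here `k = 2` and the `k` outputs are combined
by a query combiner instead of a vote, as a many-one reduction must produce one query.)
[Arora–Barak 2009, Thm. 7.10 (proof) and Exercise 7.4]
[cite: AroraBarak2009, §7.4.1 and Exercise 7.4] -/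
def _root_.Literature.Computability.Complexity.RandAlg.orTwice (A : RandAlg (List Bool) (List Bool)) (g : List Bool → List Bool) :
    RandAlg (List Bool) (List Bool) where
  run x r := g (Complexity.boolPair (A.run x (everyOther true r)) (A.run x (everyOther false r)))
  coinLen n := A.coinLen n + A.coinLen n

/-- The run map of `A.orTwice g` (definitional). [folklore] -/
@[simp] theorem _root_.Literature.Computability.Complexity.RandAlg.orTwice_run (A : RandAlg (List Bool) (List Bool)) (g : List Bool → List Bool)
    (x r : List Bool) :
    (A.orTwice g).run x r =
      g (Complexity.boolPair (A.run x (everyOther true r)) (A.run x (everyOther false r))) :=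
  rfl

/-- The coin budget of `A.orTwice g` is `2 · A.coinLen` (definitional). [folklore] -/
@[simp] theorem _root_.Literature.Computability.Complexity.RandAlg.orTwice_coinLen (A : RandAlg (List Bool) (List Bool)) (g : List Bool → List Bool)
    (n : ℕ) : (A.orTwice g).coinLen n = A.coinLen n + A.coinLen n :=
  rfl

/-- The run map `(x, r) ↦ A.run x r` of a probabilistic polynomial-time string algorithm, read
as a total string function through `boolUnpair`, is in `FP`: compose the machine of `A`
(specified on inputs `boolPair x r`) after the re-pairing normaliser
(`polyTimeComputable_boolUnpair`). [Arora–Barak 2009, §0.1 (pairing), Claim 1.6]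
[cite: AroraBarak2009, Claim 1.6] -/
theorem _root_.Literature.Computability.Complexity.RandAlg.uncurry_run_comp_boolUnpair_mem_FP {A : RandAlg (List Bool) (List Bool)}
    (hA : A.IsPolyTime id (id : List Bool → List Bool)) :
    (Function.uncurry A.run ∘ Complexity.boolUnpair) ∈ Complexity.FP :=
  Complexity.PolyTimeComputable.comp_holds hA.1 Complexity.polyTimeComputable_boolUnpair

/-- **`A.orTwice g` is probabilistic polynomial time** for `A` probabilistic polynomial time and
`g ∈ FP`: through the pairing `⟨x, r⟩`, its run map is the composite
`g ∘ mapSndFn B₀ ∘ mapFstFn B₁ ∘ copyFn`,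
`B_b = (uncurry A.run ∘ boolUnpair) ∘ mapSndFn (everyOther b)`, of maps in `FP`
(`⟨x,r⟩ ↦ ⟨⟨x,r⟩,⟨x,r⟩⟩ ↦ ⟨y₁,⟨x,r⟩⟩ ↦ ⟨y₁,y₂⟩ ↦ g ⟨y₁,y₂⟩`), and its coin budget is bounded by
`2p` if that of `A` is bounded by `p` ("the running time of `M'` is `k` times that of `M` plus
the combination"). [Arora–Barak 2009, Thm. 7.10 (proof) with Claim 1.6 /
Thm. 2.8 (composition)] [cite: AroraBarak2009, Thm. 7.10 (proof) and Claim 1.6] -/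
theorem _root_.Literature.Computability.Complexity.RandAlg.orTwice_isPolyTime {A : RandAlg (List Bool) (List Bool)}
    (hA : A.IsPolyTime id (id : List Bool → List Bool)) {g : List Bool → List Bool}
    (hg : g ∈ Complexity.FP) : (A.orTwice g).IsPolyTime id (id : List Bool → List Bool) := by
  obtain ⟨p, hp⟩ := hA.2
  refine ⟨?_, p + p, fun n => ?_⟩
  · set B : Bool → List Bool → List Bool :=
      fun b => (Function.uncurry A.run ∘ Complexity.boolUnpair) ∘ Complexity.mapSndFn (everyOther b) with hB
    have hBFP : ∀ b, B b ∈ Complexity.FP := fun b =>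
      Complexity.comp_mem_FP (uncurry_run_comp_boolUnpair_mem_FP hA) (Complexity.mapSndFn_mem_FP (everyOther_mem_FP b))
    have hBapp : ∀ (b : Bool) (x r : List Bool), B b (Complexity.boolPair x r) = A.run x (everyOther b r) := by
      intro b x r
      simp [hB]
    have hG : (g ∘ Complexity.mapSndFn (B false) ∘ Complexity.mapFstFn (B true) ∘ Complexity.copyFn) ∈ Complexity.FP :=
      Complexity.comp_mem_FP hg (Complexity.comp_mem_FP (Complexity.mapSndFn_mem_FP (hBFP false))
        (Complexity.comp_mem_FP (Complexity.mapFstFn_mem_FP (hBFP true)) Complexity.copyFn_mem_FP))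
    refine Complexity.PolyTimeComputable.of_encode_eq
      (f := g ∘ Complexity.mapSndFn (B false) ∘ Complexity.mapFstFn (B true) ∘ Complexity.copyFn) (ea := id) (eb := id)
      (fun q : List Bool × List Bool => Complexity.boolPair q.1 q.2) (fun _ => rfl) (fun q => ?_) hG
    obtain ⟨x, r⟩ := q
    simp [Complexity.copyFn_apply, hBapp]
  · rw [Polynomial.eval_add]
    exact Nat.add_le_add (hp n) (hp n)

end RandAlg

end Literature.Computability.MetaComplexity

namespace Literature.Computability.MetaComplexity

open _root_.Computability Complexity

/-- **Discharge of `PolyTimeRPReducible.polyTimeRandReducible`** (one-sided randomized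
reductions to an OR-closed target are two-sided randomized reductions, Arora–Barak Def. 7.16).
Given the one-sided reduction `A` (success `≥ 1/2` on `x ∈ L₁`, probability `0` of landing in
`L₂` on `x ∉ L₁`, over coins of length `m = coinLen |x|`) and the OR-combiner `g ∈ FP`, the
two-sided reduction is `A.orTwice g` (`RandAlg.orTwice_isPolyTime`). Correctness, counted over
the `2^{2m}` coin strings (`RandAlg.pr_eq_uniformProb`): if `x ∈ L₁`, at least `2^{m-1}` blocks
land in `L₂`, so by the product rule `cnt_everyOther` at most `4^m / 4` strings have both halves
failing and `Pr[g ⟨y₁, y₂⟩ ∈ L₂] ≥ 3/4 ≥ 2/3` (`two_mul_pow_le_three_mul_cnt_everyOther_or`);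
if `x ∉ L₁`, probability `0` means no block of length `m` lands in `L₂` (`cnt_pos_iff`), both
halves of every string of length `2m` have length `m` (`length_everyOther_of_length_eq`), so
every coin string gives the correct verdict `g ⟨y₁, y₂⟩ ∉ L₂`. This is the error reduction
for one-sided error by independent repetition (Arora–Barak §7.3 `RP ⊆ BPP`, §7.4.1/Thm. 7.10
and Exercise 7.4), with the OR taken inside the target language via `g` because a many-one
reduction must output a single query. [Arora–Barak 2009, Def. 7.16 (p. 138); §7.3 (p. 131);
§7.4.1, Thm. 7.10 (p. 132) and Exercise 7.4 (pp. 141–142); Valiant–Vazirani 1986, §1]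
[cite: AroraBarak2009, Def. 7.16 and §7.4.1 (Thm. 7.10 and Exercise 7.4)] -/
theorem PolyTimeRPReducible.polyTimeRandReducible_holds :
    PolyTimeRPReducible.polyTimeRandReducible := by
  intro L₁ L₂ hRP hor
  obtain ⟨A, hA, hyes, hno⟩ := hRP
  obtain ⟨g, hg, hgor⟩ := hor
  refine ⟨A.orTwice g, RandAlg.orTwice_isPolyTime hA hg, fun x => ?_⟩
  rw [RandAlg.pr_eq_uniformProb]
  change 2 / 3 ≤ uniformProb (A.coinLen x.length + A.coinLen x.length)
    {y | g (boolPair (A.run x (everyOther true y)) (A.run x (everyOther false y))) ∈ L₂ ↔ x ∈ L₁}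
  simp_rw [hgor]
  -- the one-sided hypotheses, as integer statements about the blocks of length `m`
  have hyes' : x ∈ L₁ →
      2 ^ A.coinLen x.length ≤ 2 * cnt (A.coinLen x.length) {c | A.run x c ∈ L₂} := by
    intro hx
    have h := hyes x hx
    rw [RandAlg.pr_eq_uniformProb] at h
    change (1 : ℝ) / 2 ≤ uniformProb (A.coinLen x.length) {c | A.run x c ∈ L₂} at h
    rw [uniformProb_eq_cnt_div, le_div_iff₀ (by positivity)] at h
    have h' : ((2 ^ A.coinLen x.length : ℕ) : ℝ) ≤
        ((2 * cnt (A.coinLen x.length) {c | A.run x c ∈ L₂} : ℕ) : ℝ) := by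
      push_cast; linarith
    exact_mod_cast h'
  have hno' : x ∉ L₁ → ∀ c : List Bool, c.length = A.coinLen x.length → A.run x c ∉ L₂ := by
    intro hx c hc hcL
    have h := hno x hx
    rw [RandAlg.pr_eq_uniformProb] at h
    change uniformProb (A.coinLen x.length) {c | A.run x c ∈ L₂} = 0 at h
    rw [uniformProb_eq_cnt_div, div_eq_zero_iff] at h
    have h0 : cnt (A.coinLen x.length) {c | A.run x c ∈ L₂} = 0 := by
      rcases h with h | h
      · exact_mod_cast h
      · exact absurd h (by positivity)
    have hpos : 0 < cnt (A.coinLen x.length) {c | A.run x c ∈ L₂} :=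
      (cnt_pos_iff _ _).2 ⟨c, hc, hcL⟩
    omega
  rw [uniformProb_eq_cnt_div, le_div_iff₀ (by positivity)]
  generalize hm : A.coinLen x.length = m at *
  set E : Set (List Bool) := {c | A.run x c ∈ L₂} with hE
  by_cases hx : x ∈ L₁
  · -- `x ∈ L₁`: a good even half or a good odd half suffices
    have hset : {y : List Bool | (A.run x (everyOther true y) ∈ L₂ ∨
        A.run x (everyOther false y) ∈ L₂ ↔ x ∈ L₁)} =
          {y | everyOther true y ∈ E ∨ everyOther false y ∈ E} := by
      ext y; simp only [Set.mem_setOf_eq, hx, iff_true, hE]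
    rw [hset]
    have key := two_mul_pow_le_three_mul_cnt_everyOther_or (hyes' hx)
    have key' : ((2 * 2 ^ (m + m) : ℕ) : ℝ) ≤
        ((3 * cnt (m + m)
          {y : List Bool | everyOther true y ∈ E ∨ everyOther false y ∈ E} : ℕ) : ℝ) := by
      exact_mod_cast key
    push_cast at key'
    linarith
  · -- `x ∉ L₁`: no block of length `m` lands in `L₂`, so every coin string is correct
    have hall : cnt (m + m)
        {y : List Bool | (A.run x (everyOther true y) ∈ L₂ ∨
          A.run x (everyOther false y) ∈ L₂ ↔ x ∈ L₁)} = 2 ^ (m + m) :=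
      cnt_eq_two_pow_of_forall fun y hy => by
        simp only [Set.mem_setOf_eq, hx, iff_false, not_or]
        exact ⟨hno' hx _ (length_everyOther_of_length_eq hy true),
          hno' hx _ (length_everyOther_of_length_eq hy false)⟩
    rw [hall]
    push_cast
    nlinarith [pow_pos (show (0 : ℝ) < 2 by norm_num) (m + m)]

end Literature.Computability.MetaComplexity
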